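import Summits.RiemannHypothesis.RiemannHypothesis.Theorems.TiltedLandingLaw421R3Lens1CoverageR
import Summits.RiemannHypothesis.RiemannHypothesis.Theorems.TiltedLandingLaw421R3Lens1SignCut

/-!
# Lens-1 file RS v1 (v9q image helper): the SUCC stub `RegHung9S` := binders of `RegRes8S` VERBATIM ∧ ¬`HungBox` ⇒ successor, and its compositions

CHECK STATUS: the module imports `…R3Lens1CoverageR` (LANDED) and `…R3Lens1SignCut` (= `lens-1/SignCut-v2.lean` 0a8482f7, row (3i), landing); until the
latter is built this file cannot elaborate by import — the inline probe `lens-1/CoverageRS-v1-probe.lean` (R imported, S v2 body inlined verbatim, this body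
appended) gives farm rc 0 · 0 sorry · `TiltedLandingLaw421R_of_regHung9S` axioms = [propext, Classical.choice, Quot.sound]; re-run `lean check` on THIS file the
hour `…R3Lens1SignCut` lands (expected rc 0 unchanged).
Declares `RegHung9S` (the v9q SUCC stub: every binder and exclusion of `RegRes8S` verbatim, plus ¬`RhW08.Lens1SignCut.HungBox f x₀ R Hs j`),
`regHung9S_of_regRes8S` (never stronger than the v8q stub), `regHung9S_of_regHungS` (implied by module S's landed-name residual),
`regRes8S_of_regHung9S` (the hung-box door `succ_of_hungBox` discharges the new binder), and
`TiltedLandingLaw421R_of_regHung9S : RegHung9S → RhW08.RateSplit.RateLawsHalfQ → crux` BY NAME.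
0 sorry.  Nothing here bears on the truth of RH; RH is not proved; ⟨33346⟩/⟨33347⟩ stay OPEN (`RegHung9S` and `RateLawsHalfQ` are hypotheses). -/

namespace RhW08.Lens1Coverage

set_option linter.dupNamespace false

open Complex Set
open scoped ComplexConjugate
open Literature.Analysis.Complex
open Summit.RiemannHypothesis.RiemannHypothesis.Theorems.Splittings.JensenWindow
open RhIdea6.G17.W07C7 RhIdea6.G17.W07C7.Rev6 RhIdea6.G18.W07C8.Law421BirthS RhIdea6.G19.W07C11.Seam
open RhIdea6.G20.W07C12.Frac RhIdea6.G20.W07C12.StColP RhW07.C12.FieldSplit RhIdea6.G21.W07C13.TentMax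
open RhW07.C14.TwoSided RhW07.C14.Classes RhW07.C14.Lineage RhW07.C14.Booking
open RhW07.C13.Heredity RhIdea6.G22.W07C15pre.Injection RhW07.E3.Cell RhW07.E3.Lit
open RhW08.Round1 RhW08.StSwap RhW08.Round2 RhW08.QuadW RhW08.SealSwapQ RhW08.SealSwap RhW08.SuccB RhW08.SuccSplit
open RhW08.SuccTheft RhW08.Column RhW08.Hurwitz RhW08.ClusterQ RhW08.ClusterQM RhW08.NewtonDoor RhW08.NewtonDoorGenusOne RhW08.PurseP
open RhW08.AntiEscapeSplit7

open RhW08.Lens1SignCut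

/-- ★ THE v9q SUCC STUB `RegHung9S` (OPEN): the binders and exclusions of `RegRes8S` verbatim, plus «`f^{(j)}` admits no hung signed box at
level `j`» (¬ `HungBox`, module S) ⇒ a level-`(j+1)` band state.  WHY IT MIGHT FAIL: the exile lens (NODE v10 §4). -/
def RegHung9S : Prop :=
  ∀ (η : ℝ) (f : ℂ → ℂ) (x₀ s hmax R Hs : ℝ) (B : ℕ), EngineHyps5 2 η f x₀ s hmax R Hs B → ∀ (j : ℕ) (v : ℂ),
    IsLowest StTrkDQ η f x₀ s hmax R Hs B j v → ¬ ReadyR2 η f x₀ s hmax R Hs B j v →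
    ¬ AllInBandInRangeWindow f x₀ R Hs j v → ¬ Dimple f j v → DiscOverlap f j v →
    iteratedDeriv (j + 1) f v ≠ 0 →
    ¬ CellF f j v → ¬ CellNb f x₀ R Hs j v → ¬ LandingDipDeep f x₀ R Hs j v → ¬ LandingDipW f x₀ R Hs j v →
    ¬ IsolatedNewtonL f x₀ R Hs j v → ¬ HungBox f x₀ R Hs j → ∃ u : ℂ, StTrkDQ η f x₀ s hmax R Hs B (j + 1) u

/-- Monotonicity: the v8q stub `RegRes8S` implies `RegHung9S` (one more hypothesis, ignored). -/
theorem regHung9S_of_regRes8S (hX : RegRes8S) : RegHung9S :=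
  fun η f x₀ s hmax R Hs B hE j v hlow hnR hwin hdim hov hz hnF hnNb hnD hnW hnI _ =>
    hX η f x₀ s hmax R Hs B hE j v hlow hnR hwin hdim hov hz hnF hnNb hnD hnW hnI

/-- Monotonicity: module S's landed-name residual `RegHungS` implies `RegHung9S` (two more hypotheses, ignored). -/
theorem regHung9S_of_regHungS (hX : RegHungS) : RegHung9S :=
  fun η f x₀ s hmax R Hs B hE j v hlow hnR hwin hdim hov hz hnF hnNb hnD _ _ hB =>
    hX η f x₀ s hmax R Hs B hE j v hlow hnR hwin hdim hov hz hnF hnNb hnD hB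

/-- ★ The hung-box door discharges the new binder: `RegHung9S ⇒ RegRes8S` (`RhW08.Lens1SignCut.succ_of_hungBox`). -/
theorem regRes8S_of_regHung9S (hX : RegHung9S) : RegRes8S := by
  intro η f x₀ s hmax R Hs B hE j v hlow hnR hwin hdim hov hz hnF hnNb hnD hnW hnI
  by_cases hB : HungBox f x₀ R Hs j
  · exact succ_of_hungBox hE hlow.1 hnR hB
  exact hX η f x₀ s hmax R Hs B hE j v hlow hnR hwin hdim hov hz hnF hnNb hnD hnW hnI hB

/-- ★★ THE CRUX BY NAME from the v9q stubs (`RegHung9S`, lens-2's `RateLawsHalfQ`), via `TiltedLandingLaw421R_of_resS`. -/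
theorem TiltedLandingLaw421R_of_regHung9S (hX : RegHung9S) (hR : RhW08.RateSplit.RateLawsHalfQ) :
    Summit.RiemannHypothesis.RiemannHypothesis.Theses.EarlyAppointments.TiltedLandingLaw421R :=
  TiltedLandingLaw421R_of_resS (regRes8S_of_regHung9S hX) hR

end RhW08.Lens1Coverage
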